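import Mathlib
import HarnessLib
import Summits.HubbardSuperconductivity.HubbardSuperconductivity.Theorems.KLProgrammeKLRegimeTwoVolumeTorusBlocks
import Literature.MathematicalPhysics.QuantumLattice.HubbardGridFieldSubstitution
import Literature.Probability.LatticeModels.TorusCentredLift

/-!
# One-volume data conversions for the β′ two-volume step (response form)

The model step `hubbardGrid_sum_norm_kernel_sub_le_response` takes, for the fine grid covariance `C′` on the grid legs over `(ℤ/Lf)²`:
the all-times far row tail `T`, the fixed-time far spatial sums `Te`, and the first moment `m₁′` in the REDUCED (coarse) torus distance.
The natural one-volume exports are `(1 + tnorm)`-weighted row sums (all times) and their fixed-time ("sectional") twins.  This file converts: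

* `tnorm_reduce_sub_reduce_le` — the coarse torus distance of the coordinatewise reductions is at most the fine torus distance (`L ∣ Lf`);
  hence `m₁′ ≤` the fine first moment (`sum_norm_mul_tnorm_reduce_le`);
* `sum_far_norm_le_of_weightedRow` — `Σ_{R < tnorm} ‖C′ X′ Y′‖ ≤ αw/(R+1)` from `Σ ‖C′ X′ Y′‖·(1 + tnorm) ≤ αw` (so `T := αw/(R+1)`);
* `sum_sectional_far_norm_le_of_sectionalMoment` — the same at a fixed time/spin/charge (so `Te := e₁/(R+1)`, `e₁` the sectional moment).
-/

namespace Summit.HubbardSuperconductivity.HubbardSuperconductivity.Theorems.TwoVolumeDefect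

open Finset Literature.MathematicalPhysics.QuantumLattice Literature.Probability.LatticeModels

section Reduce

variable {d L Lf : ℕ} [NeZero L] [NeZero Lf]

omit [NeZero L] in
/-- The coordinatewise reduction `(ℤ/Lf)ᵈ → (ℤ/L)ᵈ`, `x ↦ (x.val : ℤ/L)`, of a difference is the projection of the centred representative of the
difference (`L ∣ Lf`). -/
theorem reduce_sub_reduce_eq_proj_cRep (hLf : L ∣ Lf) (x y : TorusSite d Lf) :
    ((fun i => (((x i).val : ℕ) : ZMod L)) - fun i => (((y i).val : ℕ) : ZMod L)) = Torus.proj L (Torus.cRep (x - y)) := by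
  funext i
  set ψ : ZMod Lf →+* ZMod L := ZMod.castHom hLf (ZMod L) with hψ
  have hψval : ∀ a : ZMod Lf, ψ a = ((a.val : ℕ) : ZMod L) := fun a => by
    rw [hψ, ZMod.castHom_apply, ZMod.cast_eq_val]
  have h1 : ψ ((x - y) i) = ((Torus.cRepZ ((x - y) i) : ℤ) : ZMod L) := by
    conv_lhs => rw [← Torus.intCast_cRepZ ((x - y) i)]
    exact map_intCast ψ _
  simp only [Pi.sub_apply, Torus.proj_apply, Torus.cRep]
  rw [← hψval, ← hψval, ← map_sub, ← Pi.sub_apply, h1]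

/-- **The coarse torus distance of the reductions is at most the fine torus distance** (`L ∣ Lf`). -/
theorem tnorm_reduce_sub_reduce_le (hLf : L ∣ Lf) (x y : TorusSite d Lf) :
    Torus.tnorm ((fun i => (((x i).val : ℕ) : ZMod L)) - fun i => (((y i).val : ℕ) : ZMod L)) ≤ Torus.tnorm (x - y) := by
  rw [reduce_sub_reduce_eq_proj_cRep hLf]
  exact Torus.tnorm_proj_le _

end Reduce

section Rows

variable {L Lf N : ℕ} [NeZero L] [NeZero Lf]

/-- `m₁′` (the first moment in the reduced distance) is at most the fine first moment, row by row. -/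
theorem sum_norm_mul_tnorm_reduce_le (hLf : L ∣ Lf) (C' : Matrix (GridLeg (GridPoint Lf N)) (GridLeg (GridPoint Lf N)) ℂ)
    (X' : GridLeg (GridPoint Lf N)) :
    ∑ Y', ‖C' X' Y'‖ * (Torus.tnorm ((fun i => (((X'.1.1.2 i).val : ℕ) : ZMod L)) - fun i => (((Y'.1.1.2 i).val : ℕ) : ZMod L)) : ℝ) ≤
      ∑ Y', ‖C' X' Y'‖ * (Torus.tnorm (X'.1.1.2 - Y'.1.1.2) : ℝ) :=
  sum_le_sum fun Y' _ => mul_le_mul_of_nonneg_left (by exact_mod_cast tnorm_reduce_sub_reduce_le hLf _ _) (norm_nonneg _)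

omit [NeZero L] in
/-- **The all-times far row tail from the weighted row sum**: `Σ_{Y′ : R < tnorm(x′−y′)} ‖C′ X′ Y′‖ ≤ αw/(R+1)` whenever
`Σ_{Y′} ‖C′ X′ Y′‖·(1 + tnorm(x′−y′)) ≤ αw`. -/
theorem sum_far_norm_le_of_weightedRow (C' : Matrix (GridLeg (GridPoint Lf N)) (GridLeg (GridPoint Lf N)) ℂ) (R : ℕ) {αw : ℝ}
    (X' : GridLeg (GridPoint Lf N)) (hrow : ∑ Y', ‖C' X' Y'‖ * (1 + (Torus.tnorm (X'.1.1.2 - Y'.1.1.2) : ℝ)) ≤ αw) :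
    ∑ Y' ∈ univ.filter (fun Y' : GridLeg (GridPoint Lf N) => R < Torus.tnorm (X'.1.1.2 - Y'.1.1.2)), ‖C' X' Y'‖ ≤ αw / ((R : ℝ) + 1) := by
  have h := sum_filter_le_div_of_weight univ (fun Y' => ‖C' X' Y'‖) (fun Y' : GridLeg (GridPoint Lf N) => Torus.tnorm (X'.1.1.2 - Y'.1.1.2))
    (fun _ _ => norm_nonneg _) R
  refine h.trans ?_
  rw [div_eq_inv_mul]
  refine mul_le_mul_of_nonneg_left (le_trans (sum_le_sum fun Y' _ => ?_) hrow) (by positivity)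
  nlinarith [norm_nonneg (C' X' Y'), (Nat.cast_nonneg (Torus.tnorm (X'.1.1.2 - Y'.1.1.2)) : (0 : ℝ) ≤ _)]

omit [NeZero L] in
/-- **The fixed-time far spatial sums from the sectional moment**: at a fixed `(t, σ, c)`,
`Σ_{y : R < tnorm(x′−y)} ‖C′ X′ (((t,y),σ),c)‖ ≤ e₁/(R+1)` whenever `Σ_y ‖C′ X′ (((t,y),σ),c)‖·(1 + tnorm(x′−y)) ≤ e₁`. -/
theorem sum_sectional_far_norm_le_of_sectionalMoment (C' : Matrix (GridLeg (GridPoint Lf N)) (GridLeg (GridPoint Lf N)) ℂ) (R : ℕ) {e₁ : ℝ}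
    (X' : GridLeg (GridPoint Lf N)) (t : Fin N) (σ c : Fin 2)
    (hsec : ∑ y : TorusSite 2 Lf, ‖C' X' (((t, y), σ), c)‖ * (1 + (Torus.tnorm (X'.1.1.2 - y) : ℝ)) ≤ e₁) :
    ∑ y ∈ univ.filter (fun y : TorusSite 2 Lf => R < Torus.tnorm (X'.1.1.2 - y)), ‖C' X' (((t, y), σ), c)‖ ≤ e₁ / ((R : ℝ) + 1) := by
  have h := sum_filter_le_div_of_weight univ (fun y : TorusSite 2 Lf => ‖C' X' (((t, y), σ), c)‖)
    (fun y : TorusSite 2 Lf => Torus.tnorm (X'.1.1.2 - y)) (fun _ _ => norm_nonneg _) R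
  refine h.trans ?_
  rw [div_eq_inv_mul]
  refine mul_le_mul_of_nonneg_left (le_trans (sum_le_sum fun y _ => ?_) hsec) (by positivity)
  nlinarith [norm_nonneg (C' X' (((t, y), σ), c)), (Nat.cast_nonneg (Torus.tnorm (X'.1.1.2 - y)) : (0 : ℝ) ≤ _)]

end Rows

end Summit.HubbardSuperconductivity.HubbardSuperconductivity.Theorems.TwoVolumeDefect
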